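import Literature.Analysis.Complex.PQExtDeriv
import Literature.Analysis.Complex.DbarFrame
import HarnessLib

/-!
# The `∂̄`-frames of flat `(p,q)`-forms on `ℂ^ι`

Instantiation of `Literature.Analysis.Complex.DbarFrame` (the creation/annihilation calculus used in
Hörmander's proof of Theorem 2.3.3, `Literature/Analysis/Complex/DbarFrame.lean`) on the Banach
spaces `Λ^{p,m}_d = typeSubmodule (ι → ℂ) d p m` of alternating `d`-forms of pointwise type
`(p,m)` on `ℂ^ι` (zero unless `d = p + m`; the degree is kept explicit and syntactic) (`Literature/Analysis/Complex/PQTypes.lean`):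

* creation `dz̄_j ∧ ·` (`wedgeOne (dzBar j)`, type `(p,m) → (p,m+1)`,
  `IsOfTypeAt.wedgeOne_of_conj`) and annihilation `∂/∂z̄_j ⌟ ·` (`dbarContract e_j`, type
  `(p,m+1) → (p,m)`, `IsOfTypeAt.dbarContract`) restricted to the type subspaces
  (`wedgeBarT`, `contractT`);
* `pqFrame ι n p q : DbarFrame ι Λ^{p,q}_n Λ^{p,q+1}_{n+1} Λ^{p,q+2}_{n+2} Λ^{p,q+3}_{n+3}` (data of type
  `(p,q+2)`), and the bottom frame `pqFrameZero ι n p : DbarFrame ι 0 Λ^{p,0}_n Λ^{p,1}_{n+1} Λ^{p,2}_{n+2}`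
  (data of type `(p,1)`, with `Λ^{p,-1} = 0`): the CAR identities are those of
  `Literature/Analysis/Complex/DbarContraction.lean`, positivity of the `dz̄`-degree is
  `IsOfTypeAt.eq_zero_of_forall_dbarContract` (`Literature/Analysis/Complex/PQOperators.lean`);
* `coe_dbar₁_pqFrame`/`coe_dbar₁_pqFrameZero`: on these frames `𝔉.dbar₁ u = ∑_j dz̄_j ∧ ∂̄_j u`, i.e. the frame
  `∂̄` is the coordinate `∂̄` of `Literature/Analysis/Complex/PQExtDeriv.lean`.

## References

* L. Hörmander, *An Introduction to Complex Analysis in Several Variables*, 2nd ed. (1973),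
  §2.1 and the proof of Thm. 2.3.3. [HormanderSCV1973]
-/

noncomputable section

open scoped ComplexConjugate
open Complex Function ContinuousAlternatingMap
open Literature.LinearAlgebra.Alternating

namespace Literature.Analysis.Complex

variable {ι : Type*} [Fintype ι] [DecidableEq ι]

/-! ### Linearity of `∂/∂z̄_v ⌟` in `v` -/

section ContractLeft

variable {E : Type*} [NormedAddCommGroup E] [NormedSpace ℂ E]
  {F : Type*} [NormedAddCommGroup F] [NormedSpace ℂ F] {n : ℕ}

/-- `∂/∂z̄_{v+w} ⌟ = ∂/∂z̄_v ⌟ + ∂/∂z̄_w ⌟`. [folklore] -/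
theorem dbarContract_add_left (v w : E) (η : E [⋀^Fin (n + 1)]→L[ℝ] F) :
    dbarContract (v + w) η = dbarContract v η + dbarContract w η := by
  simp only [dbarContract_eq, smul_add, map_add]
  abel

/-- `∂/∂z̄_{c v} ⌟ = c̄ ∂/∂z̄_v ⌟` (conjugate-linearity in the vector). [folklore] -/
theorem dbarContract_smul_left (c : ℂ) (v : E) (η : E [⋀^Fin (n + 1)]→L[ℝ] ℂ) :
    dbarContract (c • v) η = conj c • dbarContract v η := by
  ext u
  simp only [dbarContract_apply, ContinuousAlternatingMap.smul_apply, smul_eq_mul]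
  rw [map_vecCons_smul_add_I, mul_left_comm]

/-- On `ℂ^ι`, if `∂/∂z̄_j ⌟ η = 0` for all coordinates `j` then `∂/∂z̄_w ⌟ η = 0` for all `w`.
[folklore] -/
theorem dbarContract_eq_zero_of_forall_single (η : (ι → ℂ) [⋀^Fin (n + 1)]→L[ℝ] ℂ)
    (h : ∀ j, dbarContract (Pi.single j 1) η = 0) (w : ι → ℂ) : dbarContract w η = 0 := by
  rw [eq_sum_smul_single w]
  have : ∀ s : Finset ι, dbarContract (∑ j ∈ s, w j • (Pi.single j (1 : ℂ) : ι → ℂ)) η = 0 := by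
    intro s
    induction s using Finset.induction_on with
    | empty => simp [dbarContract_eq]
    | insert a s ha ih => rw [Finset.sum_insert ha, dbarContract_add_left, ih, dbarContract_smul_left,
        h a, smul_zero, zero_add]
  exact this _

end ContractLeft

/-! ### The type subspaces `Λ^{p,m} ⊆ Λ^d` and the restricted operators -/

/-- The Banach space `Λ^{p,m}_d` of alternating `d`-forms on `ℂ^ι` of pointwise type `(p,m)` (the zero
space unless `d = p + m`; the total degree `d` is kept explicit so that the creation/annihilation
operators change it syntactically by one). [cite: HormanderSCV1973, §2.1] -/
abbrev TypeSpace (ι : Type*) [Fintype ι] (d p m : ℕ) : Type _ :=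
  ↥(typeSubmodule (ι → ℂ) d p m)

omit [DecidableEq ι] in
/-- Elements of `Λ^{p,m}_d` are fixed by the type projection. [folklore] -/
theorem typeProjAt_coe {d p m : ℕ} (y : TypeSpace ι d p m) :
    typeProjAt p m (y : (ι → ℂ) [⋀^Fin d]→L[ℝ] ℂ) = y :=
  y.2

omit [DecidableEq ι] in
/-- Elements of `Λ^{p,m}_d` have pointwise type `(p,m)` when `p + m = d`. [folklore] -/
theorem isOfTypeAt_coe {d p m : ℕ} (h : p + m = d) (y : TypeSpace ι d p m) :
    IsOfTypeAt p m (y : (ι → ℂ) [⋀^Fin d]→L[ℝ] ℂ) :=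
  isOfTypeAt_of_mem_typeSubmodule h y.2

omit [DecidableEq ι] in
/-- Elements of `Λ^{p,m}_d` vanish when `p + m ≠ d`. [folklore] -/
theorem coe_eq_zero_of_ne {d p m : ℕ} (h : p + m ≠ d) (y : TypeSpace ι d p m) :
    (y : (ι → ℂ) [⋀^Fin d]→L[ℝ] ℂ) = 0 := by
  rw [← typeProjAt_coe y, typeProjAt_of_ne h]

omit [DecidableEq ι] in
/-- `dz̄_l ∧ ·` maps `Λ^{p,m}_d` into `Λ^{p,m+1}_{d+1}`. [cite: HormanderSCV1973, §2.1] -/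
theorem wedgeOne_dzBar_mem {d p m : ℕ} (l : ι) (y : TypeSpace ι d p m) :
    wedgeOne (dzBar l) (y : (ι → ℂ) [⋀^Fin d]→L[ℝ] ℂ) ∈ typeSubmodule (ι → ℂ) (d + 1) p (m + 1) := by
  by_cases h : p + m = d
  · exact ((isOfTypeAt_coe h y).wedgeOne_of_conj fun c w => by
      rw [dzBar_apply, dzBar_apply, Pi.smul_apply, smul_eq_mul, map_mul]).mem_typeSubmodule
  · rw [coe_eq_zero_of_ne h, wedgeOne_zero]
    exact Submodule.zero_mem _

/-- `∂/∂z̄_j ⌟ ·` maps `Λ^{p,m+1}_{d+1}` into `Λ^{p,m}_d`. [cite: HormanderSCV1973, §2.1] -/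
theorem dbarContract_mem {d p m : ℕ} (j : ι) (y : TypeSpace ι (d + 1) p (m + 1)) :
    dbarContract (Pi.single j 1) (y : (ι → ℂ) [⋀^Fin (d + 1)]→L[ℝ] ℂ) ∈ typeSubmodule (ι → ℂ) d p m := by
  by_cases h : p + (m + 1) = d + 1
  · exact ((isOfTypeAt_coe h y).dbarContract _).mem_typeSubmodule
  · rw [coe_eq_zero_of_ne h, _root_.map_zero]
    exact Submodule.zero_mem _

/-- **Creation operator** `dz̄_l ∧ · : Λ^{p,m}_d → Λ^{p,m+1}_{d+1}` as a `ℂ`-linear continuous map.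
[cite: HormanderSCV1973, §2.1] -/
def wedgeBarT (d p m : ℕ) (l : ι) : TypeSpace ι d p m →L[ℂ] TypeSpace ι (d + 1) p (m + 1) :=
  ((wedgeOneL (dzBar l)).comp (typeSubmodule (ι → ℂ) d p m).subtypeL).codRestrict
    (typeSubmodule (ι → ℂ) (d + 1) p (m + 1)) fun y => wedgeOne_dzBar_mem l y

/-- **Annihilation operator** `∂/∂z̄_j ⌟ · : Λ^{p,m+1}_{d+1} → Λ^{p,m}_d` as a `ℂ`-linear continuous
map. [cite: HormanderSCV1973, §2.1] -/
def contractT (d p m : ℕ) (j : ι) : TypeSpace ι (d + 1) p (m + 1) →L[ℂ] TypeSpace ι d p m :=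
  ((dbarContract (Pi.single j 1)).comp (typeSubmodule (ι → ℂ) (d + 1) p (m + 1)).subtypeL).codRestrict
    (typeSubmodule (ι → ℂ) d p m) fun y => dbarContract_mem j y

omit [DecidableEq ι] in
/-- Values of `wedgeBarT`. [folklore] -/
@[simp]
theorem coe_wedgeBarT {d p m : ℕ} (l : ι) (y : TypeSpace ι d p m) :
    (wedgeBarT d p m l y : (ι → ℂ) [⋀^Fin (d + 1)]→L[ℝ] ℂ) = wedgeOne (dzBar l) (y : _) :=
  rfl

/-- Values of `contractT`. [folklore] -/
@[simp]
theorem coe_contractT {d p m : ℕ} (j : ι) (y : TypeSpace ι (d + 1) p (m + 1)) :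
    (contractT d p m j y : (ι → ℂ) [⋀^Fin d]→L[ℝ] ℂ) = dbarContract (Pi.single j 1) (y : _) :=
  rfl

/-! ### The frames -/

/-- **The `∂̄`-frame of `(p,·)`-forms on `ℂ^ι`** on the levels `Λ^{p,q}_n, Λ^{p,q+1}_{n+1},
Λ^{p,q+2}_{n+2}, Λ^{p,q+3}_{n+3}` (data of type `(p,q+2)`; in use `n = p + q`): creation
`dz̄_j ∧ ·`, annihilation `∂/∂z̄_j ⌟ ·`, the CAR identities of the exterior algebra and positivity
of the `dz̄`-degree (Hörmander (1973), §2.1 and proof of Thm. 2.3.3). [cite: HormanderSCV1973, Thm. 2.3.3] -/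
def pqFrame (ι : Type*) [Fintype ι] [DecidableEq ι] (n p q : ℕ) :
    DbarFrame ι (TypeSpace ι n p q) (TypeSpace ι (n + 1) p (q + 1)) (TypeSpace ι (n + 2) p (q + 2))
      (TypeSpace ι (n + 3) p (q + 3)) where
  ε₀ := wedgeBarT n p q
  ε₁ := wedgeBarT (n + 1) p (q + 1)
  ε₂ := wedgeBarT (n + 2) p (q + 2)
  ι₀ := contractT n p q
  ι₁ := contractT (n + 1) p (q + 1)
  ι₂ := contractT (n + 2) p (q + 2)
  car₁_self j y := by
    apply Subtype.ext
    simpa using dbarContract_single_wedgeOne_dzBar j j (y : (ι → ℂ) [⋀^Fin (n + 1)]→L[ℝ] ℂ)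
  car₁_ne j l hjl y := by
    apply Subtype.ext
    simpa [hjl] using dbarContract_single_wedgeOne_dzBar j l (y : (ι → ℂ) [⋀^Fin (n + 1)]→L[ℝ] ℂ)
  car₂_self j x := by
    apply Subtype.ext
    simpa using dbarContract_single_wedgeOne_dzBar j j (x : (ι → ℂ) [⋀^Fin (n + 2)]→L[ℝ] ℂ)
  car₂_ne j l hjl x := by
    apply Subtype.ext
    simpa [hjl] using dbarContract_single_wedgeOne_dzBar j l (x : (ι → ℂ) [⋀^Fin (n + 2)]→L[ℝ] ℂ)
  ε_ε j l y := by
    apply Subtype.ext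
    simpa using eq_neg_of_add_eq_zero_left
      (wedgeOne_wedgeOne_add_swap (dzBar j) (dzBar l) (y : (ι → ℂ) [⋀^Fin (n + 1)]→L[ℝ] ℂ))
  ι_ι j k x := by
    apply Subtype.ext
    simpa using dbarContract_dbarContract_swap (Pi.single j 1) (Pi.single k 1)
      (x : (ι → ℂ) [⋀^Fin (n + 2)]→L[ℝ] ℂ)
  eq_zero_of_forall_ι₁ x hx := by
    apply Subtype.ext
    by_cases h : p + (q + 2) = n + 2
    · exact (isOfTypeAt_coe h x).eq_zero_of_forall_dbarContract
        (dbarContract_eq_zero_of_forall_single _ fun j => congr_arg Subtype.val (hx j))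
    · exact coe_eq_zero_of_ne h x

omit [DecidableEq ι] in
/-- `∂/∂z̄_v ⌟ η = 0` for `η` of type `(p,0)` (`η` is then `ℂ`-linear in its first slot).
[folklore] -/
theorem IsOfTypeAt.dbarContract_eq_zero_of_type_zero {n : ℕ} {η : (ι → ℂ) [⋀^Fin (n + 1)]→L[ℝ] ℂ}
    (hη : IsOfTypeAt (n + 1) 0 η) (v : ι → ℂ) : Literature.Analysis.Complex.dbarContract v η = 0 := by
  ext u
  have h := hη.map_update_smul (Matrix.vecCons v u) 0 I
  simp only [Matrix.cons_val_zero] at h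
  rw [show update (Matrix.vecCons v u) 0 (I • v) = Matrix.vecCons (I • v) u from by
    ext i; refine Fin.cases ?_ (fun j => ?_) i <;> simp] at h
  simp only [dbarContract_apply, h, smul_eq_mul]
  rw [show ((0 : (ι → ℂ) [⋀^Fin n]→L[ℝ] ℂ) u) = 0 from rfl]
  linear_combination ((2 : ℂ)⁻¹ * η (Matrix.vecCons v u)) * I_mul_I

omit [DecidableEq ι] in
/-- On `Λ^{p,0}_{n+1}` the contractions vanish. [folklore] -/
theorem dbarContract_coe_typeZero {n p : ℕ} (y : TypeSpace ι (n + 1) p 0) (v : ι → ℂ) :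
    Literature.Analysis.Complex.dbarContract v (y : (ι → ℂ) [⋀^Fin (n + 1)]→L[ℝ] ℂ) = 0 := by
  by_cases h : p + 0 = n + 1
  · obtain rfl : p = n + 1 := by omega
    exact (isOfTypeAt_coe h y).dbarContract_eq_zero_of_type_zero v
  · rw [coe_eq_zero_of_ne h, _root_.map_zero]

/-- **The bottom `∂̄`-frame of `(p,·)`-forms on `ℂ^ι`**: levels `0 = Λ^{p,-1}, Λ^{p,0}_n, Λ^{p,1}_{n+1},
Λ^{p,2}_{n+2}` (data of type `(p,1)`; in use `n = p`); on `Λ^{p,0}` the annihilation operators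
vanish (forms of type `(p,0)` are `ℂ`-multilinear). [cite: HormanderSCV1973, Thm. 2.3.3] -/
def pqFrameZero (ι : Type*) [Fintype ι] [DecidableEq ι] (n p : ℕ) :
    DbarFrame ι (⊥ : Submodule ℂ ((ι → ℂ) [⋀^Fin n]→L[ℝ] ℂ)) (TypeSpace ι n p 0)
      (TypeSpace ι (n + 1) p 1) (TypeSpace ι (n + 2) p 2) where
  ε₀ _ := 0
  ε₁ := wedgeBarT n p 0
  ε₂ := wedgeBarT (n + 1) p 1
  ι₀ _ := 0
  ι₁ := contractT n p 0
  ι₂ := contractT (n + 1) p 1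
  car₁_self j y := by
    apply Subtype.ext
    simp only [zero_apply, _root_.map_zero, add_zero, coe_contractT, coe_wedgeBarT]
    cases n with
    | zero =>
      have h := dbarContract_single_wedgeOne_dzBar_zero j j (y : (ι → ℂ) [⋀^Fin 0]→L[ℝ] ℂ)
      rwa [if_pos rfl] at h
    | succ n' =>
      have h := dbarContract_single_wedgeOne_dzBar j j (y : (ι → ℂ) [⋀^Fin (n' + 1)]→L[ℝ] ℂ)
      rwa [dbarContract_coe_typeZero y, wedgeOne_zero, add_zero, if_pos rfl] at h
  car₁_ne j l hjl y := by
    apply Subtype.ext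
    simp only [zero_apply, _root_.map_zero, add_zero, coe_contractT, coe_wedgeBarT,
      ZeroMemClass.coe_zero]
    cases n with
    | zero =>
      have h := dbarContract_single_wedgeOne_dzBar_zero j l (y : (ι → ℂ) [⋀^Fin 0]→L[ℝ] ℂ)
      rwa [if_neg hjl] at h
    | succ n' =>
      have h := dbarContract_single_wedgeOne_dzBar j l (y : (ι → ℂ) [⋀^Fin (n' + 1)]→L[ℝ] ℂ)
      rwa [dbarContract_coe_typeZero y, wedgeOne_zero, add_zero, if_neg hjl] at h
  car₂_self j x := by
    apply Subtype.ext
    simpa using dbarContract_single_wedgeOne_dzBar j j (x : (ι → ℂ) [⋀^Fin (n + 1)]→L[ℝ] ℂ)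
  car₂_ne j l hjl x := by
    apply Subtype.ext
    simpa [hjl] using dbarContract_single_wedgeOne_dzBar j l (x : (ι → ℂ) [⋀^Fin (n + 1)]→L[ℝ] ℂ)
  ε_ε j l y := by
    apply Subtype.ext
    simpa using eq_neg_of_add_eq_zero_left
      (wedgeOne_wedgeOne_add_swap (dzBar j) (dzBar l) (y : (ι → ℂ) [⋀^Fin n]→L[ℝ] ℂ))
  ι_ι j k x := by
    change (0 : (⊥ : Submodule ℂ ((ι → ℂ) [⋀^Fin n]→L[ℝ] ℂ))) = -0
    exact (neg_zero (G := (⊥ : Submodule ℂ ((ι → ℂ) [⋀^Fin n]→L[ℝ] ℂ)))).symm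
  eq_zero_of_forall_ι₁ x hx := by
    apply Subtype.ext
    by_cases h : p + 1 = n + 1
    · exact (isOfTypeAt_coe h x).eq_zero_of_forall_dbarContract
        (dbarContract_eq_zero_of_forall_single _ fun j => congr_arg Subtype.val (hx j))
    · exact coe_eq_zero_of_ne h x

/-! ### The frame `∂̄` is the coordinate `∂̄` -/

/-- On the frames of `(p,·)`-forms, `𝔉.dbar₁ u (z) = ∑_j dz̄_j ∧ ∂̄_j u (z)` after forgetting the
type: the frame `∂̄` is Hörmander's coordinate `∂̄` (`PQExtDeriv`). The differentiability
hypothesis is taken in the form produced by `ContDiff` (normed-space instances of the subtype).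
[cite: HormanderSCV1973, §2.1] -/
theorem coe_dbar₁_pqFrame {n p q : ℕ} {u : (ι → ℂ) → TypeSpace ι (n + 1) p (q + 1)} {z : ι → ℂ}
    (hu : ContDiffAt ℝ 1 u z) :
    ((pqFrame ι n p q).dbar₁ u z : (ι → ℂ) [⋀^Fin (n + 1 + 1)]→L[ℝ] ℂ) =
      ∑ j, wedgeOne (dzBar j) (dbarAlong (Pi.single j 1) (fun y => (u y : (ι → ℂ) [⋀^Fin (n + 1)]→L[ℝ] ℂ)) z) := by
  rw [DbarFrame.dbar₁_apply, Submodule.coe_sum]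
  refine Finset.sum_congr rfl fun j _ => ?_
  change ((wedgeBarT (n + 1) p (q + 1) j (dbarAlong (Pi.single j 1) u z) : TypeSpace ι (n + 1 + 1) p (q + 1 + 1)) :
    (ι → ℂ) [⋀^Fin (n + 1 + 1)]→L[ℝ] ℂ) = _
  rw [coe_wedgeBarT]
  congr 1
  exact (dbarAlong_clm_comp (F := TypeSpace ι (n + 1) p (q + 1))
    ((typeSubmodule (ι → ℂ) (n + 1) p (q + 1)).subtypeL) (hu.differentiableAt one_ne_zero) _).symm

/-- The same for the bottom frame. [cite: HormanderSCV1973, §2.1] -/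
theorem coe_dbar₁_pqFrameZero {n p : ℕ} {u : (ι → ℂ) → TypeSpace ι n p 0} {z : ι → ℂ}
    (hu : ContDiffAt ℝ 1 u z) :
    ((pqFrameZero ι n p).dbar₁ u z : (ι → ℂ) [⋀^Fin (n + 1)]→L[ℝ] ℂ) =
      ∑ j, wedgeOne (dzBar j) (dbarAlong (Pi.single j 1) (fun y => (u y : (ι → ℂ) [⋀^Fin n]→L[ℝ] ℂ)) z) := by
  rw [DbarFrame.dbar₁_apply, Submodule.coe_sum]
  refine Finset.sum_congr rfl fun j _ => ?_
  change ((wedgeBarT n p 0 j (dbarAlong (Pi.single j 1) u z) : TypeSpace ι (n + 1) p (0 + 1)) :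
    (ι → ℂ) [⋀^Fin (n + 1)]→L[ℝ] ℂ) = _
  rw [coe_wedgeBarT]
  congr 1
  exact (dbarAlong_clm_comp (F := TypeSpace ι n p 0)
    ((typeSubmodule (ι → ℂ) n p 0).subtypeL) (hu.differentiableAt one_ne_zero) _).symm

end Literature.Analysis.Complex
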